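import Summits.CriticalPhenomena.SAWScalingLimit.Theorems.SAWDefectDecoherenceBoundaryClosureRBoundaryDataTransferFloorValue
import HarnessLib

/-!
# Boundary data transfer, V-a: flat regularity at one scale

Route `SAWDefectDecoherence`, crux `BoundaryClosureR` (stmt-CriticalPhenomena-14004), line
`pick-half-plane`, stub `stub_engineBoundaryData` (r13): hypothesis (I4) of the landed
`pickEngine_stage2` for every engine limit — the one-scale lattice side.  At a scale where the root is
a floor dart, the normaliser a floor dart (walk `γ_b` of winding `π + 2πj_b`) and a reference dart of
the flat window about a flat point `y ≠ x` is reached by `γ₀` (winding `π + 2πj₀`):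

* `flatLine_at` — the floor-site increments along the window lie on the line `u·ℝ`,
  `u = −i e^{i(3/8)2π(j₀ − j_b)}` (`flatSegment_frame`), which depends on `j₀ − j_b mod 8` only
  (`segmentPhase_eq_of_class`); so `h z − h y` is within `ε` of `u·ℝ` once the floor-site values are
  within `ε/2` of `h z`, `h y`;
* `flatTan_at` — the lower window-mass bound of `FlatMassLaws` (a) inside `ball y (t/2)` and the
  exact segment norm `flatSegment_norm` give `(√3/12)C⁻¹ t ≤ ‖h(y+t) − h(y−t)‖ + ε`;
* `sum_range_eq_sum_Ico` / `boundaryDataTransfer_sumRangeIco` (registered), `column_mem_window`,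
  `exists_dart_of_mass_pos` (a reference dart from a positive window mass), `eventually_flatFrame`
  (eventually the flat window about `y` consists of exact flat floor cells off the root and a
  reference dart of it is reached from the root).
-/

noncomputable section

open scoped Topology
open Filter Set
open Complex (I exp)
open Literature.Probability.LatticeModels Literature.Probability.RandomPlanarGeometry
open Literature.Probability.RandomPlanarGeometry.SAW
open Summit.CriticalPhenomena.SAWScalingLimit.Theorems.PickHalfPlane.RootWedge
open Summit.CriticalPhenomena.SAWScalingLimit.Theorems.PickHalfPlane.DevelopingMaps
open Summit.CriticalPhenomena.SAWScalingLimit.Theorems.PickHalfPlane.BoundaryExactness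

namespace Summit.CriticalPhenomena.SAWScalingLimit.Theorems.PickHalfPlane.BoundaryDataTransfer

/-- Reindexing a range sum as a column sum. [folklore] -/
theorem sum_range_eq_sum_Ico (f : ℤ → ℝ) (k : ℤ) :
    ∀ n : ℕ, ∑ i ∈ Finset.range n, f (k + i) = ∑ j ∈ Finset.Ico k (k + n), f j := by
  intro n
  induction n with
  | zero => simp
  | succ n ih =>
    rw [Finset.sum_range_succ, ih, show k + ((n + 1 : ℕ) : ℤ) = k + n + 1 by push_cast; ring,
      Ico_add_one_eq_insert (show k ≤ k + n by omega), Finset.sum_insert Finset.right_notMem_Ico]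
    ring

/-- **Registered helper `boundaryDataTransfer_sumRangeIco`** (crux stmt-CriticalPhenomena-14004, line
`pick-half-plane`, stub `stub_engineBoundaryData`): reindexing a range sum along a floor segment as a
column sum, ∀-closed (`sum_range_eq_sum_Ico`). [folklore] -/
theorem boundaryDataTransfer_sumRangeIco : ∀ (f : ℤ → ℝ) (k : ℤ) (n : ℕ), ∑ i ∈ Finset.range n, f (k + i) = ∑ j ∈ Finset.Ico k (k + n), f j :=
  fun f k n => sum_range_eq_sum_Ico f k n

/-- Columns of a window about `y`: under `|re w − re y| < ρ₁` and `δ ≤ ρ₁`, the column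
`⌊re w/δ − M/2⌋` has `|δ(k + M/2) − re y| < 2ρ₁`, hence lies in the integer window of half-width
`2ρ₁`. [folklore] -/
theorem column_mem_window {δ ρ₁ : ℝ} (hδ0 : 0 < δ) (hδρ : δ ≤ ρ₁) {y w : ℂ} (M : ℤ)
    (hw : |w.re - y.re| < ρ₁) :
    |δ * (⌊w.re / δ - M / 2⌋ + M / 2) - y.re| < 2 * ρ₁ ∧
    ⌈(y.re - 2 * ρ₁) / δ - M / 2⌉ ≤ ⌊w.re / δ - M / 2⌋ ∧ ⌊w.re / δ - M / 2⌋ ≤ ⌊(y.re + 2 * ρ₁) / δ - M / 2⌋ := by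
  have hcol := floorColumn_near hδ0 w.re M
  have h1 : |δ * (⌊w.re / δ - M / 2⌋ + M / 2) - y.re| < 2 * ρ₁ := by
    rw [abs_lt] at hw ⊢; constructor <;> linarith [hcol.1, hcol.2]
  exact ⟨h1, mem_Icc_window hδ0 h1⟩

/-- A reference dart from a positive window mass: if the window `∑ᶠ` of the (nonnegative) arrival
masses inside `ball y ρ₁` is positive under the lattice pin at `p₀`, some floor dart of the
threshold row with scaled midpoint in the ball carries positive mass. [folklore] -/
theorem exists_dart_of_mass_pos {Λ : Finset HexVertex} {M : ℤ} {δ R₀ ρ₁ : ℝ} {p₀ y : ℂ} (hδ : 0 ≤ δ)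
    (hpin : ∀ v : HexVertex, (δ : ℂ) * hexCenter v ∈ Metric.ball p₀ R₀ → (v ∈ Λ ↔ M ≤ v.1 1))
    (hyR : ‖y - p₀‖ + ρ₁ + δ < R₀) {Z : Sym2 HexVertex → ℝ}
    (hpos : 0 < ∑ᶠ e' ∈ {e' : Sym2 HexVertex | e' ∈ hexDomainBoundary Λ ∧
      (δ : ℂ) * hexMidpoint e' ∈ Metric.ball y ρ₁}, Z e') :
    ∃ k : ℤ, (δ : ℂ) * hexMidpoint (floorEdge k M) ∈ Metric.ball y ρ₁ ∧ Z (floorEdge k M) ≠ 0 := by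
  have hSr : ∀ w ∈ Metric.ball y ρ₁, dist w p₀ + δ / 2 < R₀ := fun w hw => by
    have h1 := Metric.mem_ball.1 hw
    have : dist w p₀ ≤ dist w y + dist y p₀ := dist_triangle _ _ _
    rw [dist_eq_norm y p₀] at this
    linarith
  by_contra hne
  push Not at hne
  refine hpos.ne' (finsum_mem_of_eqOn_zero fun e' he' => ?_)
  rw [GateMass.boundaryWindow_eq_image hδ hpin hSr] at he'
  obtain ⟨k, hk, rfl⟩ := he'
  exact hne k hk

/-- **The flat line at one scale.**  At a scale where the root is `floorEdge ka Mr`, the normaliser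
`floorEdge kb mb` (walk `γ_b` of winding `π + 2πj_b`), and a reference dart `floorEdge k₀ M` of the
flat window of real half-width `2ρ₁` about `re y` on the row `M` (not containing the root) is
reached by `γ₀` of winding `π + 2πj₀` with `j₀ − j_b ≡ j_c (mod 8)`: if the floor-site values under
`z` and `y` (`|re z − re y| < ρ₁`) are within `ε/2` of `h z`, `h y`, then `h z − h y` is within `ε`
of the line `u·ℝ`, `u = −i e^{i(3/8)2πj_c}` (`flatSegment_frame`, `segmentPhase_eq_of_class`).
[cite: DuminilCopinSmirnov2012, §4 (the map H with dH = F dz)] -/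
theorem flatLine_at {Λ : Finset HexVertex} (hΛ : hexDomainSimplyConnected Λ) {δ ρ₁ ε : ℝ} (hδ0 : 0 < δ)
    (hδρ : δ ≤ ρ₁) {y z : ℂ} {M Mr ka kb mb k₀ jb j₀ jc : ℤ} {ee bb : Sym2 HexVertex}
    (he : ee = floorEdge ka Mr) (hb : bb = floorEdge kb mb) (hUa : upFace ka Mr ∈ Λ) (hBa : belowFace ka Mr ∉ Λ)
    (hUb : upFace kb mb ∈ Λ) (hBb : belowFace kb mb ∉ Λ) (hneb : floorEdge kb mb ≠ floorEdge ka Mr)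
    (γb : HexMidEdgeSAW Λ (floorEdge ka Mr) (floorEdge kb mb)) (hwb : γb.winding = Real.pi + 2 * Real.pi * jb)
    (γ₀ : HexMidEdgeSAW Λ (floorEdge ka Mr) (floorEdge k₀ M)) (hw₀ : γ₀.winding = Real.pi + 2 * Real.pi * j₀)
    (hclass : ((j₀ - jb : ℤ) : ZMod 8) = (jc : ZMod 8)) (hk₀ : |δ * (k₀ + M / 2) - y.re| < 2 * ρ₁)
    (hW : ∀ k : ℤ, |δ * (k + M / 2) - y.re| ≤ 2 * ρ₁ →
      upFace k M ∈ Λ ∧ belowFace k M ∉ Λ ∧ ((![k, M], 1) : HexVertex) ∈ Λ ∧ ((![k - 1, M], 1) : HexVertex) ∈ Λ)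
    (hroot : ∀ k : ℤ, |δ * (k + M / 2) - y.re| ≤ 2 * ρ₁ → floorEdge k M ≠ floorEdge ka Mr)
    {H : Site 2 → ℂ} (hH : IsPotential Λ ee H) {sb : Site 2} {h : ℂ → ℂ} (hzy : |z.re - y.re| < ρ₁)
    (hvz : ‖(δ : ℂ) * (H ![⌊z.re / δ - M / 2⌋, M] - H sb) /
      hexParafermionicObservable Λ ee hexCriticalFugacity (5 / 8) bb - h z‖ ≤ ε / 2)
    (hvy : ‖(δ : ℂ) * (H ![⌊y.re / δ - M / 2⌋, M] - H sb) /
      hexParafermionicObservable Λ ee hexCriticalFugacity (5 / 8) bb - h y‖ ≤ ε / 2) :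
    ∃ t : ℝ, ‖h z - h y - (-(I * exp (I * (3 / 8 : ℂ) * ((2 * Real.pi * jc : ℝ) : ℂ)))) * t‖ ≤ ε := by
  have hF := flat_of_window hδ0 hW
  have hroot' : ∀ k : ℤ, ⌈(y.re - 2 * ρ₁) / δ - M / 2⌉ ≤ k → k ≤ ⌊(y.re + 2 * ρ₁) / δ - M / 2⌋ →
      floorEdge k M ≠ floorEdge ka Mr := fun k hk1 hk2 =>
    hroot k (GateMass.abs_le_of_mem_Icc hδ0 (Finset.mem_Icc.2 ⟨hk1, hk2⟩))
  obtain ⟨hk₀₁, hk₀₂⟩ := mem_Icc_window hδ0 hk₀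
  obtain ⟨-, haz₁, haz₂⟩ := column_mem_window hδ0 hδρ M hzy
  obtain ⟨-, hay₁, hay₂⟩ := column_mem_window hδ0 hδρ M (show |y.re - y.re| < ρ₁ by rw [sub_self, abs_zero]; linarith)
  have hH' : IsPotential Λ (floorEdge ka Mr) H := by rw [← he]; exact hH
  set az : ℤ := ⌊z.re / δ - M / 2⌋ with haz
  set ay : ℤ := ⌊y.re / δ - M / 2⌋ with hay
  set Fb := hexParafermionicObservable Λ ee hexCriticalFugacity (5 / 8) bb with hFb
  have hobs : Fb = hexParafermionicObservable Λ (floorEdge ka Mr) hexCriticalFugacity (5 / 8) (floorEdge kb mb) := by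
    rw [hFb, he, hb]
  have hphase : exp (I * (3 / 8 : ℂ) * ((γ₀.winding - γb.winding : ℝ) : ℂ)) =
      exp (I * (3 / 8 : ℂ) * ((2 * Real.pi * jc : ℝ) : ℂ)) := by
    rw [show (γ₀.winding - γb.winding : ℝ) = 2 * Real.pi * ((j₀ - jb : ℤ) : ℝ) by rw [hw₀, hwb]; push_cast; ring]
    exact segmentPhase_eq_of_class hclass
  set u : ℂ := -(I * exp (I * (3 / 8 : ℂ) * ((2 * Real.pi * jc : ℝ) : ℂ))) with hu
  -- the common estimate
  have key : ∀ t : ℝ, (H ![az, M] - H ![ay, M]) /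
      hexParafermionicObservable Λ (floorEdge ka Mr) hexCriticalFugacity (5 / 8) (floorEdge kb mb) = u * t →
      ∃ t' : ℝ, ‖h z - h y - u * t'‖ ≤ ε := by
    intro t ht
    refine ⟨δ * t, ?_⟩
    have e1 : h z - h y - u * ((δ * t : ℝ) : ℂ) =
        -((δ : ℂ) * (H ![az, M] - H sb) / Fb - h z) + ((δ : ℂ) * (H ![ay, M] - H sb) / Fb - h y) +
          ((δ : ℂ) * ((H ![az, M] - H ![ay, M]) /
            hexParafermionicObservable Λ (floorEdge ka Mr) hexCriticalFugacity (5 / 8) (floorEdge kb mb)) -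
            u * ((δ * t : ℝ) : ℂ)) := by
      rw [hobs]; push_cast; ring
    rw [e1, ht, show (δ : ℂ) * (u * t) - u * ((δ * t : ℝ) : ℂ) = 0 by push_cast; ring, add_zero]
    calc ‖-((δ : ℂ) * (H ![az, M] - H sb) / Fb - h z) + ((δ : ℂ) * (H ![ay, M] - H sb) / Fb - h y)‖
        ≤ ‖-((δ : ℂ) * (H ![az, M] - H sb) / Fb - h z)‖ + ‖(δ : ℂ) * (H ![ay, M] - H sb) / Fb - h y‖ :=
          norm_add_le _ _
      _ ≤ ε / 2 + ε / 2 := by rw [norm_neg]; exact add_le_add hvz hvy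
      _ = ε := add_halves ε
  by_cases hle : ay ≤ az
  · have hn : ay + ((az - ay).toNat : ℕ) = az := by rw [Int.toNat_of_nonneg (by omega)]; ring
    have hseg := flatSegment_frame hΛ hUa hBa hF hroot' hk₀₁ hk₀₂ γ₀ hUb hBb hneb γb hH' (az - ay).toNat ay hay₁
      (by rw [hn]; omega)
    rw [hn, hphase] at hseg
    exact key _ hseg
  · have hn : az + ((ay - az).toNat : ℕ) = ay := by rw [Int.toNat_of_nonneg (by omega)]; ring
    have hseg := flatSegment_frame hΛ hUa hBa hF hroot' hk₀₁ hk₀₂ γ₀ hUb hBb hneb γb hH' (ay - az).toNat az haz₁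
      (by rw [hn]; omega)
    rw [hn, hphase] at hseg
    obtain ⟨R, hR⟩ : ∃ R : ℝ, (H ![ay, M] - H ![az, M]) /
        hexParafermionicObservable Λ (floorEdge ka Mr) hexCriticalFugacity (5 / 8) (floorEdge kb mb) = u * R :=
      ⟨_, hseg⟩
    refine key (-R) ?_
    rw [← neg_sub, neg_div, hR]; push_cast; ring


/-- **The tangential lower bound at one scale.**  At a scale as in `flatLine_at` (reference dart
`k₀` of the window reached by `γ₀`; lattice pin at `p₀` of radius `R₀` with
`‖y − p₀‖ + ρ₁ + δ < R₀`): if the window mass inside `ball y (t/2)` is at least `C⁻¹(t/2)Z_b/δ`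
(the lower bound of `FlatMassLaws` (a)), `δ ≤ t < ρ₁`, and the floor-site values under `zp, zm`
(`re z± = re y ± t`) are within `ε/2` of `h zp`, `h zm`, then
`(√3/12)C⁻¹·t ≤ ‖h zp − h zm‖ + ε` (`flatSegment_norm`, window identification, column sums).
[cite: DuminilCopinSmirnov2012, §4 (the map H with dH = F dz)] -/
theorem flatTan_at {Λ : Finset HexVertex} (hΛ : hexDomainSimplyConnected Λ) {δ ρ₁ ε t C R₀ : ℝ} (hδ0 : 0 < δ)
    (hδt : δ ≤ t) (htρ : t < ρ₁) {p₀ y zp zm : ℂ} {M Mr ka kb mb k₀ : ℤ} {ee bb : Sym2 HexVertex}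
    (he : ee = floorEdge ka Mr) (hb : bb = floorEdge kb mb) (hUa : upFace ka Mr ∈ Λ) (hBa : belowFace ka Mr ∉ Λ)
    (hUb : upFace kb mb ∈ Λ) (hBb : belowFace kb mb ∉ Λ) (hneb : floorEdge kb mb ≠ floorEdge ka Mr)
    (γb : HexMidEdgeSAW Λ (floorEdge ka Mr) (floorEdge kb mb))
    (γ₀ : HexMidEdgeSAW Λ (floorEdge ka Mr) (floorEdge k₀ M)) (hk₀ : |δ * (k₀ + M / 2) - y.re| < 2 * ρ₁)
    (hW : ∀ k : ℤ, |δ * (k + M / 2) - y.re| ≤ 2 * ρ₁ →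
      upFace k M ∈ Λ ∧ belowFace k M ∉ Λ ∧ ((![k, M], 1) : HexVertex) ∈ Λ ∧ ((![k - 1, M], 1) : HexVertex) ∈ Λ)
    (hroot : ∀ k : ℤ, |δ * (k + M / 2) - y.re| ≤ 2 * ρ₁ → floorEdge k M ≠ floorEdge ka Mr)
    (hpin : ∀ v : HexVertex, (δ : ℂ) * hexCenter v ∈ Metric.ball p₀ R₀ → (v ∈ Λ ↔ M ≤ v.1 1))
    (hyR : ‖y - p₀‖ + ρ₁ + δ < R₀)
    {H : Site 2 → ℂ} (hH : IsPotential Λ ee H) {sb : Site 2} {h : ℂ → ℂ}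
    (hzp : zp.re = y.re + t) (hzm : zm.re = y.re - t)
    (hmass : C⁻¹ * (t / 2) * ‖hexParafermionicObservable Λ ee hexCriticalFugacity 0 bb‖ ≤
      δ * ∑ᶠ e' ∈ {e' : Sym2 HexVertex | e' ∈ hexDomainBoundary Λ ∧
          (δ : ℂ) * hexMidpoint e' ∈ Metric.ball y (t / 2)}, ‖hexParafermionicObservable Λ ee hexCriticalFugacity 0 e'‖)
    (hvp : ‖(δ : ℂ) * (H ![⌊zp.re / δ - M / 2⌋, M] - H sb) /
      hexParafermionicObservable Λ ee hexCriticalFugacity (5 / 8) bb - h zp‖ ≤ ε / 2)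
    (hvm : ‖(δ : ℂ) * (H ![⌊zm.re / δ - M / 2⌋, M] - H sb) /
      hexParafermionicObservable Λ ee hexCriticalFugacity (5 / 8) bb - h zm‖ ≤ ε / 2) :
    Real.sqrt 3 / 12 * C⁻¹ * t ≤ ‖h zp - h zm‖ + ε := by
  have ht0 : 0 < t := lt_of_lt_of_le hδ0 hδt
  have hδρ : δ ≤ ρ₁ := by linarith
  have hF := flat_of_window hδ0 hW
  have hroot' : ∀ k : ℤ, ⌈(y.re - 2 * ρ₁) / δ - M / 2⌉ ≤ k → k ≤ ⌊(y.re + 2 * ρ₁) / δ - M / 2⌋ →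
      floorEdge k M ≠ floorEdge ka Mr := fun k hk1 hk2 =>
    hroot k (GateMass.abs_le_of_mem_Icc hδ0 (Finset.mem_Icc.2 ⟨hk1, hk2⟩))
  obtain ⟨hk₀₁, hk₀₂⟩ := mem_Icc_window hδ0 hk₀
  obtain ⟨-, hap₁, hap₂⟩ := column_mem_window hδ0 hδρ M (show |zp.re - y.re| < ρ₁ by
    rw [hzp, add_sub_cancel_left, abs_of_pos ht0]; exact htρ)
  obtain ⟨-, ham₁, ham₂⟩ := column_mem_window hδ0 hδρ M (show |zm.re - y.re| < ρ₁ by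
    rw [hzm, show y.re - t - y.re = -t by ring, abs_neg, abs_of_pos ht0]; exact htρ)
  have hH' : IsPotential Λ (floorEdge ka Mr) H := by rw [← he]; exact hH
  set ap : ℤ := ⌊zp.re / δ - M / 2⌋ with hap
  set am : ℤ := ⌊zm.re / δ - M / 2⌋ with ham
  have hcp := floorColumn_near hδ0 zp.re M
  have hcm := floorColumn_near hδ0 zm.re M
  rw [← hap] at hcp; rw [← ham] at hcm
  rw [hzp] at hcp; rw [hzm] at hcm
  have hlt : ∀ {i i' : ℤ}, δ * (i + M / 2) < δ * (i' + M / 2) → i < i' := fun {i i'} hlt => by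
    have h1 : δ * i < δ * i' := by linarith
    have : (i : ℝ) < i' := lt_of_mul_lt_mul_left h1 hδ0.le
    exact_mod_cast this
  have hampm : am < ap := hlt (by linarith)
  have hn : am + ((ap - am).toNat : ℕ) = ap := by rw [Int.toNat_of_nonneg (by omega)]; ring
  set Fb := hexParafermionicObservable Λ ee hexCriticalFugacity (5 / 8) bb with hFb
  have hobs : Fb = hexParafermionicObservable Λ (floorEdge ka Mr) hexCriticalFugacity (5 / 8) (floorEdge kb mb) := by
    rw [hFb, he, hb]
  set Z : Sym2 HexVertex → ℝ := fun e' => ‖hexParafermionicObservable Λ (floorEdge ka Mr) hexCriticalFugacity 0 e'‖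
    with hZ
  have hZb := (normaliser_observable hΛ hUa hBa hUb hBb hneb γb).2
  rw [he, hb] at hmass
  -- the segment norm
  have hseg := flatSegment_norm hΛ hUa hBa hF hroot' hk₀₁ hk₀₂ γ₀ hUb hBb hneb γb hH' (ap - am).toNat am ham₁
    (by rw [hn]; omega)
  have hsum := sum_range_eq_sum_Ico (fun j => Z (floorEdge j M)) am (ap - am).toNat
  rw [hn, ← Finset.sum_div, hsum, hn] at hseg
  -- the window sum is dominated by the column sum
  have hSr : ∀ w ∈ Metric.ball y (t / 2), dist w p₀ + δ / 2 < R₀ := fun w hw => by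
    have h1 := Metric.mem_ball.1 hw
    have : dist w p₀ ≤ dist w y + dist y p₀ := dist_triangle _ _ _
    rw [dist_eq_norm y p₀] at this
    linarith
  have hwin : ∑ᶠ e' ∈ {e' : Sym2 HexVertex | e' ∈ hexDomainBoundary Λ ∧
      (δ : ℂ) * hexMidpoint e' ∈ Metric.ball y (t / 2)}, Z e' ≤ ∑ k ∈ Finset.Ico am ap, Z (floorEdge k M) := by
    rw [GateMass.finsum_boundaryWindow_eq hδ0.le hpin hSr]
    refine finsum_window_le_sum_Ico (fun _ => norm_nonneg _) fun k hk => ?_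
    rw [Metric.mem_ball, dist_eq_norm] at hk
    have h1 := Complex.abs_re_le_norm ((δ : ℂ) * hexMidpoint (floorEdge k M) - y)
    rw [Complex.sub_re, re_scaled_hexMidpoint_floorEdge] at h1
    have h2 := abs_lt.1 (lt_of_le_of_lt h1 hk)
    exact ⟨(hlt (by linarith [h2.1])).le, hlt (by linarith [h2.2])⟩
  -- combine
  have hdiff : δ * ‖(H ![ap, M] - H ![am, M]) /
      hexParafermionicObservable Λ (floorEdge ka Mr) hexCriticalFugacity (5 / 8) (floorEdge kb mb)‖ ≤
      ‖h zp - h zm‖ + ε := by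
    have e1 : (δ : ℂ) * ((H ![ap, M] - H ![am, M]) /
        hexParafermionicObservable Λ (floorEdge ka Mr) hexCriticalFugacity (5 / 8) (floorEdge kb mb)) =
        ((δ : ℂ) * (H ![ap, M] - H sb) / Fb - h zp) - ((δ : ℂ) * (H ![am, M] - H sb) / Fb - h zm) +
          (h zp - h zm) := by rw [hobs]; ring
    have := norm_add₃_le (a := (δ : ℂ) * (H ![ap, M] - H sb) / Fb - h zp)
      (b := -((δ : ℂ) * (H ![am, M] - H sb) / Fb - h zm)) (c := h zp - h zm)
    rw [norm_neg, ← sub_eq_add_neg, ← e1, norm_mul, Complex.norm_real, Real.norm_of_nonneg hδ0.le] at this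
    linarith
  have hlow : Real.sqrt 3 / 12 * C⁻¹ * t ≤ δ * ‖(H ![ap, M] - H ![am, M]) /
      hexParafermionicObservable Λ (floorEdge ka Mr) hexCriticalFugacity (5 / 8) (floorEdge kb mb)‖ := by
    have key := hmass.trans (mul_le_mul_of_nonneg_left hwin hδ0.le)
    have h6 : (0 : ℝ) ≤ Real.sqrt 3 / 6 := by positivity
    rw [hseg, show δ * (Real.sqrt 3 / 6 * ((∑ j ∈ Finset.Ico am ap, Z (floorEdge j M)) /
        ‖hexParafermionicObservable Λ (floorEdge ka Mr) hexCriticalFugacity 0 (floorEdge kb mb)‖)) =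
        Real.sqrt 3 / 6 * (δ * ∑ j ∈ Finset.Ico am ap, Z (floorEdge j M)) /
        ‖hexParafermionicObservable Λ (floorEdge ka Mr) hexCriticalFugacity 0 (floorEdge kb mb)‖ by ring,
      le_div_iff₀ hZb]
    calc Real.sqrt 3 / 12 * C⁻¹ * t * ‖hexParafermionicObservable Λ (floorEdge ka Mr) hexCriticalFugacity 0 (floorEdge kb mb)‖
        = Real.sqrt 3 / 6 * (C⁻¹ * (t / 2) *
          ‖hexParafermionicObservable Λ (floorEdge ka Mr) hexCriticalFugacity 0 (floorEdge kb mb)‖) := by ring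
      _ ≤ Real.sqrt 3 / 6 * (δ * ∑ j ∈ Finset.Ico am ap, Z (floorEdge j M)) := mul_le_mul_of_nonneg_left key h6
  exact hlow.trans hdiff


section Frame

/-! ### The flat frame, eventually -/

variable {D : DobrushinDomain} {ρ : ℝ} {Λ : ℝ → Finset HexVertex} {m : ℝ → ℤ} {b : ℝ → Sym2 HexVertex}
  (hAF : 0 < ρ ∧
    D.carrier ∩ Metric.ball (D.pt 1) ρ = {z : ℂ | (D.pt 1).im < z.im} ∩ Metric.ball (D.pt 1) ρ ∧
    (∀ᶠ δ : ℝ in 𝓝[>] 0, hexDomainSimplyConnected (Λ δ) ∧ b δ ∈ hexDomainBoundary (Λ δ) ∧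
      (hexGraph.induce ((Λ δ : Finset HexVertex) : Set HexVertex)).Preconnected ∧
      (∀ v ∈ Λ δ, (δ : ℂ) * hexCenter v ∈ D.carrier) ∧
      (∀ v : HexVertex, (δ : ℂ) * hexCenter v ∈ Metric.ball (D.pt 1) ρ →
        (v ∈ Λ δ ↔ m δ ≤ v.1 1))) ∧
    (∀ K : Set ℂ, IsCompact K → K ⊆ D.carrier →
      ∀ᶠ δ : ℝ in 𝓝[>] 0, ∀ v : HexVertex, (δ : ℂ) * hexCenter v ∈ K → v ∈ Λ δ) ∧
    Tendsto (fun δ : ℝ => (δ : ℂ) * hexMidpoint (b δ)) (𝓝[>] 0) (𝓝 (D.pt 1)))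
  {x : ℂ} {e : ℝ → Sym2 HexVertex} {r : ℝ} {mr : ℝ → ℤ}
  (hPR : 0 < r ∧ D.carrier ∩ Metric.ball x r = {z : ℂ | x.im < z.im} ∩ Metric.ball x r ∧
    (∀ᶠ δ : ℝ in 𝓝[>] 0, e δ ∈ hexDomainBoundary (Λ δ) ∧
      Nonempty (HexMidEdgeSAW (Λ δ) (e δ) (b δ)) ∧
      (∀ v : HexVertex, (δ : ℂ) * hexCenter v ∈ Metric.ball x r → (v ∈ Λ δ ↔ mr δ ≤ v.1 1))) ∧
    Tendsto (fun δ : ℝ => (δ : ℂ) * hexMidpoint (e δ)) (𝓝[>] 0) (𝓝 x))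
  (hx : x ≠ D.pt 1)

include hAF hPR

include hx

/-- **The flat frame at a flat point, eventually.**  In the frame of a pinned flat piece at a point
`y ≠ x` of the piece (window radius `ρ₁` with `‖y − p₀‖ + 4ρ₁ ≤ R₀`, `4ρ₁ ≤ ‖y − x‖`) with the
lower window-mass bound at radius `ρ₁`: eventually the root/normaliser frame holds, the flat
window of half-width `2ρ₁` about `re y` on the threshold row consists of exact flat floor cells
none of which is the root dart, and a reference dart of the window is reached from the root by a
walk of winding `π + 2πj₀`. [cite: DuminilCopinSmirnov2012, §3 (the boundary part α of the strip)] -/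
theorem eventually_flatFrame {p₀ : ℂ} {R₀ : ℝ} {mf : ℝ → ℤ} {bf : ℝ → Sym2 HexVertex} (hR₀ : 0 < R₀)
    (hΩ : D.carrier ∩ Metric.ball p₀ R₀ = {z : ℂ | p₀.im < z.im} ∩ Metric.ball p₀ R₀)
    (hpin : ∀ᶠ δ : ℝ in 𝓝[>] 0, ∀ v : HexVertex,
      (δ : ℂ) * hexCenter v ∈ Metric.ball p₀ R₀ → (v ∈ Λ δ ↔ mf δ ≤ v.1 1))
    (hbd : ∀ᶠ δ : ℝ in 𝓝[>] 0, bf δ ∈ hexDomainBoundary (Λ δ))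
    (hlim : Tendsto (fun δ : ℝ => (δ : ℂ) * hexMidpoint (bf δ)) (𝓝[>] 0) (𝓝 p₀))
    {y : ℂ} (hyim : y.im = p₀.im) {ρ₁ : ℝ} (hρ₁ : 0 < ρ₁) (hρ₁R : ‖y - p₀‖ + 4 * ρ₁ ≤ R₀)
    (hρ₁x : 4 * ρ₁ ≤ ‖y - x‖) {C : ℝ} (hC : 0 < C)
    (hmass : ∀ᶠ δ : ℝ in 𝓝[>] 0, C⁻¹ * ρ₁ * ‖hexParafermionicObservable (Λ δ) (e δ) hexCriticalFugacity 0 (b δ)‖ ≤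
      δ * ∑ᶠ e' ∈ {e' : Sym2 HexVertex | e' ∈ hexDomainBoundary (Λ δ) ∧
          (δ : ℂ) * hexMidpoint e' ∈ Metric.ball y ρ₁},
        ‖hexParafermionicObservable (Λ δ) (e δ) hexCriticalFugacity 0 e'‖) :
    ∀ᶠ δ : ℝ in 𝓝[>] 0, ∃ (ka kb k₀ jb j₀ : ℤ)
      (γb : HexMidEdgeSAW (Λ δ) (floorEdge ka (mr δ)) (floorEdge kb (m δ)))
      (γ₀ : HexMidEdgeSAW (Λ δ) (floorEdge ka (mr δ)) (floorEdge k₀ (mf δ))),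
      e δ = floorEdge ka (mr δ) ∧ b δ = floorEdge kb (m δ) ∧
      upFace ka (mr δ) ∈ Λ δ ∧ belowFace ka (mr δ) ∉ Λ δ ∧ upFace kb (m δ) ∈ Λ δ ∧ belowFace kb (m δ) ∉ Λ δ ∧
      floorEdge kb (m δ) ≠ floorEdge ka (mr δ) ∧ γb.winding = Real.pi + 2 * Real.pi * jb ∧
      γ₀.winding = Real.pi + 2 * Real.pi * j₀ ∧ |δ * (k₀ + mf δ / 2) - y.re| < 2 * ρ₁ ∧
      (∀ k : ℤ, |δ * (k + mf δ / 2) - y.re| ≤ 2 * ρ₁ → upFace k (mf δ) ∈ Λ δ ∧ belowFace k (mf δ) ∉ Λ δ ∧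
        ((![k, mf δ], 1) : HexVertex) ∈ Λ δ ∧ ((![k - 1, mf δ], 1) : HexVertex) ∈ Λ δ) ∧
      (∀ k : ℤ, |δ * (k + mf δ / 2) - y.re| ≤ 2 * ρ₁ → floorEdge k (mf δ) ≠ floorEdge ka (mr δ)) := by
  have hΛΩ := hAF.2.2.1.mono fun _ h => h.2.2.2.1
  have hW := flat_window (R' := ‖y - p₀‖ + 2 * ρ₁) (by linarith) hpin hbd hlim
  have hεf : 0 < ρ₁ / 2 := by positivity
  have hnear := rootFrame_near hPR hΛΩ hεf
  have hF := pinned_frame hR₀ hεf hΩ hpin hbd hΛΩ hlim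
  have hδev : ∀ᶠ δ : ℝ in 𝓝[>] 0, δ ∈ Set.Ioo 0 (ρ₁ / 2) := Ioo_mem_nhdsGT hεf
  filter_upwards [eventually_rootGateFrame hAF hPR hx, hW, hnear, hF, hδev, hpin, hmass,
    hAF.2.2.1.mono fun _ h => h.1] with δ ⟨ka, kb, jb, γb, he, hb, hUa, hBa, hUb, hBb, hneb, hwb⟩ hWδ ⟨hne, _, _⟩
    ⟨_, _, _, hht⟩ ⟨hδ0, hδρ⟩ hpinδ hmassδ hsc
  set M : ℤ := mf δ with hM
  have hre : |y.re - p₀.re| ≤ ‖y - p₀‖ := by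
    have := Complex.abs_re_le_norm (y - p₀); rwa [Complex.sub_re] at this
  have hWy : ∀ k : ℤ, |δ * (k + M / 2) - y.re| ≤ 2 * ρ₁ → upFace k M ∈ Λ δ ∧ belowFace k M ∉ Λ δ ∧
      ((![k, M], 1) : HexVertex) ∈ Λ δ ∧ ((![k - 1, M], 1) : HexVertex) ∈ Λ δ := fun k hk =>
    hWδ k ((abs_sub_le _ y.re _).trans (by linarith))
  have hrooty : ∀ k : ℤ, |δ * (k + M / 2) - y.re| ≤ 2 * ρ₁ → floorEdge k M ≠ floorEdge ka (mr δ) := by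
    intro k hk heq
    have h1 : ‖(δ : ℂ) * hexMidpoint (floorEdge k M) - y‖ ≤ 2 * ρ₁ + δ / 2 + ρ₁ / 2 := by
      refine (Complex.norm_le_abs_re_add_abs_im _).trans ?_
      rw [Complex.sub_re, Complex.sub_im, re_scaled_hexMidpoint_floorEdge, im_scaled_hexMidpoint_floorEdge, hyim]
      have : |δ * (↑k + ↑M / 2) + δ / 2 - y.re| ≤ 2 * ρ₁ + δ / 2 := by
        rw [abs_le] at hk ⊢; constructor <;> linarith
      linarith [hht.le]
    rw [heq, ← he] at h1
    have : ‖y - x‖ < 4 * ρ₁ := by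
      calc ‖y - x‖ ≤ ‖(δ : ℂ) * hexMidpoint (e δ) - y‖ + ‖(δ : ℂ) * hexMidpoint (e δ) - x‖ := by
            rw [norm_sub_rev ((δ : ℂ) * hexMidpoint (e δ)) y]; exact norm_sub_le_norm_sub_add_norm_sub _ _ _
        _ < 4 * ρ₁ := by linarith
    linarith
  -- the reference dart
  have hZb := (normaliser_observable hsc hUa hBa hUb hBb hneb γb).2
  have hyR' : ‖y - p₀‖ + ρ₁ + δ < R₀ := by linarith
  have hpos : 0 < ∑ᶠ e' ∈ {e' : Sym2 HexVertex | e' ∈ hexDomainBoundary (Λ δ) ∧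
      (δ : ℂ) * hexMidpoint e' ∈ Metric.ball y ρ₁}, ‖hexParafermionicObservable (Λ δ) (e δ) hexCriticalFugacity 0 e'‖ := by
    have h1 : 0 < C⁻¹ * ρ₁ * ‖hexParafermionicObservable (Λ δ) (e δ) hexCriticalFugacity 0 (b δ)‖ := by
      rw [he, hb]; positivity
    by_contra hle
    push Not at hle
    have h3 := mul_nonpos_of_nonneg_of_nonpos hδ0.le hle
    have h4 := h1.trans_le hmassδ
    exact absurd (h4.trans_le h3) (lt_irrefl _)
  obtain ⟨k₀, hk₀b, hk₀Z⟩ := exists_dart_of_mass_pos hδ0.le hpinδ hyR' hpos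
  have hk₀ : |δ * (k₀ + M / 2) - y.re| < 2 * ρ₁ := by
    rw [Metric.mem_ball, dist_eq_norm] at hk₀b
    have h1 := Complex.abs_re_le_norm ((δ : ℂ) * hexMidpoint (floorEdge k₀ M) - y)
    rw [Complex.sub_re, re_scaled_hexMidpoint_floorEdge] at h1
    have h2 := abs_lt.1 (lt_of_le_of_lt h1 hk₀b)
    rw [abs_lt]; constructor <;> linarith [h2.1, h2.2]
  have hwalk : Nonempty (HexMidEdgeSAW (Λ δ) (e δ) (floorEdge k₀ M)) :=
    (GateMass.norm_obs_zero_pos_iff _ _ _).1 (lt_of_le_of_ne (norm_nonneg _) (Ne.symm hk₀Z))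
  obtain ⟨γ₀⟩ := hwalk
  rw [he] at γ₀
  obtain ⟨j₀, hj₀⟩ := exists_winding_floorDarts_eq hBa (hWy k₀ hk₀.le).2.1 (hrooty k₀ hk₀.le) γ₀
  exact ⟨ka, kb, k₀, jb, j₀, γb, γ₀, he, hb, hUa, hBa, hUb, hBb, hneb, hwb, hj₀, hk₀, hWy, hrooty⟩


end Frame

end Summit.CriticalPhenomena.SAWScalingLimit.Theorems.PickHalfPlane.BoundaryDataTransfer

end
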